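import Summits.AnomalousDissipation.AnomalousDissipation.Theorems.SawtoothPulseCascadeK1LocalisedCascadeThinBudget
import Summits.AnomalousDissipation.AnomalousDissipation.Theorems.SawtoothPulseCascadeK1LocalisedCascadeLineAverage

/-!
# K1loc, line `Spectral` — S-D (thin start): THE STRIP + OFF-CONE HYPOTHESIS IN WINDOW FORM

Helper file of the prover lane on the crux `K1LocalisedCascade` (stmt-AnomalousDissipation-19491), route
`SawtoothPulseCascade` (glue seat k1loc-p3).  The assembler's target of record (`…LedgerThinTarget`, ad-k1loc-p2 g4) is the
hypothesis `hch` of `K1Ledger.From.k1Localised_of_thin_strip_cone(_frequently)`: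
`Σ'[|k₀| ≤ L′ₙ]‖𝓕a_n‖² + Σ'[13/10·|k₀| ≤ γ|k₁|]‖𝓕a_n‖² ≤ Q < ‖datum‖²`, `L′ₙ = (1 + 1/250)·c(γ²−3)ⁿ`.
This file writes ITS LEFT-HAND SIDE IN WINDOW FORM, for any continuous real field `θ` on `T²`, `L′ > 0`, crest sign `|σ| = 1`,
`M = (13/10 − 1)L′`:
* `tsum_strip_add_cone_le_windows` (via `…LineAverage.tsum_cone_real_le_strip_add_lineDeviation`): strip + off-cone `≤ 2(πL′)²∫(∫_{−1/(4L′)}^{1/(4L′)} θ(· + ue₀)du)² + (π/(π−1))²∫(θ − M·W θ)²`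
  (`…StripAverage.tsum_strip_real_le_windowAvg` for the strip);
* `tsum_strip_add_cone_le_window_add_area`: with `|θ| ≤ B` and a measurable FLAT set `G` (`θ(x + u(1,σγ)) = θ(x)` for
  `x ∈ G`, `|u| ≤ 1/(2M)`): strip + off-cone `≤ 2(πL′)²∫(chord window)² + (π/(π−1))²(2B)²·|Gᶜ|`
  (`…ThinBudget.integral_sq_sub_lineAvg_le`).
So `hch(n)` follows from two PDE-free facts about the inviscid iterate `a_n` (`|a_n| ≤ 1`): the mean square of its chord
window averages at scale `1/(4L′ₙ)` is small, and the area of points whose crest segment of length `√(1+γ²)/M` is not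
flat (cell ends, rounding zones; one crest family, `δ₀` small) is small — uniformly (or frequently) in `n`.
General crest slope (second section): the same with `v = (1, t)`, `13/10·|t| > γ`, margin `M = (13|t|/(10γ) − 1)L′`
(`cone_indicator_le_strip_add_antislab_slope`, `tsum_cone_real_le_strip_add_lineDeviation_slope`,
`tsum_strip_add_cone_le_window_add_area_slope`) — the cells' common wave vector need not be exactly `∥ (γ, ∓1)`.
Disjoint form (third section, the hypothesis of `k1Localised_of_thin_lowBand_offCone`): `[|k₀| < L′] + [L′ ≤ |k₀| ∧ 13/10|k₀| < γ|k₁|]`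
`≤ (πL′)²∫(chord window)² + (π/(π−1))²∫(crest deviation)²` — the strip paid ONCE
(`highOffCone_indicator_le_antislab_slope`, `tsum_lowBand_add_highOffCone_le_windows_slope`,
`tsum_lowBand_add_highOffCone_le_window_add_area_slope`; approximately flat segments `|θ(x+u·v) − θ(x)| ≤ η` on `G`:
`tsum_lowBand_add_highOffCone_le_window_add_approx_slope`, bound `… + (π/(π−1))²(η² + (2B)²|Gᶜ|)`).
WHAT THIS IS NOT: no statement about the cascade itself; the two facts are S-D's.
[cite: Grafakos2014, Prop. 3.2.7 (3)] [problem: turb]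
-/

-- `Summit.<Summit>.<Problem>`: single-conjunct summit, the duplicate namespace segment is deliberate.
set_option linter.dupNamespace false

noncomputable section

namespace Summit.AnomalousDissipation.AnomalousDissipation.Theorems.SawtoothPulseCascade.K1Start

open MeasureTheory Set Filter Topology UnitAddTorus Function
open Literature.Analysis.FunctionSpaces Literature.Analysis.FunctionSpaces.Torus

/-- **Strip + off-cone in window form** (the left-hand side of `hch` of `K1Ledger.From.k1Localised_of_thin_strip_cone`):
for a continuous real field `θ` on `T²`, `L′ > 0`, `|σ| = 1`, `M = (13/10 − 1)L′`,
`Σ'[|k₀| ≤ L′]‖𝓕θ‖² + Σ'[13/10·|k₀| ≤ γ|k₁|]‖𝓕θ‖²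
  ≤ 2(πL′)²∫(∫_{−1/(4L′)}^{1/(4L′)} θ(x + ue₀)du)²dx + (π/(π−1))²∫(θ(x) − M∫_{−1/(2M)}^{1/(2M)} θ(x + u(1,σγ))du)²dx`.
[cite: Grafakos2014, Prop. 3.2.7 (3)] -/
theorem tsum_strip_add_cone_le_windows {θ : UnitAddTorus (Fin 2) → ℝ} (hθ : Continuous θ) (γ σ : ℝ) {L' : ℝ}
    (hL' : 0 < L') (hσ : |σ| = 1) :
    ∑' k : Fin 2 → ℤ, (if |((k 0 : ℤ) : ℝ)| ≤ L' then (1 : ℝ) else 0) * ‖mFourierCoeff (fun x => (θ x : ℂ)) k‖ ^ 2 +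
        ∑' k : Fin 2 → ℤ, (if 13 / 10 * |((k 0 : ℤ) : ℝ)| ≤ γ * |((k 1 : ℤ) : ℝ)| then (1 : ℝ) else 0) *
          ‖mFourierCoeff (fun x => (θ x : ℂ)) k‖ ^ 2 ≤
      2 * ((Real.pi * L') ^ 2 * ∫ x : UnitAddTorus (Fin 2),
          (∫ u in (-(1 / (4 * L')))..(1 / (4 * L')), θ (x + Pi.single 0 ((u : ℝ) : UnitAddCircle))) ^ 2) +
        (Real.pi / (Real.pi - 1)) ^ 2 * ∫ x : UnitAddTorus (Fin 2),
          (θ x - (13 / 10 - 1) * L' * ∫ u in (-(1 / (2 * ((13 / 10 - 1) * L'))))..(1 / (2 * ((13 / 10 - 1) * L'))),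
            θ (x + fun j => (((u * (![1, σ * γ] : Fin 2 → ℝ) j : ℝ)) : UnitAddCircle))) ^ 2 := by
  have hstrip := tsum_strip_real_le_windowAvg hθ (0 : Fin 2) hL'
  have hcone := tsum_cone_real_le_strip_add_lineDeviation hθ γ σ (a := 13 / 10) (by norm_num) hL' hσ
  linarith

/-- **Strip + off-cone ≤ chord windows + non-flat crest AREA**: for a continuous real field `θ` on `T²` with `|θ| ≤ B`,
`L′ > 0`, `|σ| = 1`, `M = (13/10 − 1)L′`, and a measurable set `G` with `θ(x + u(1,σγ)) = θ(x)` for `x ∈ G`, `|u| ≤ 1/(2M)`: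
`Σ'[|k₀| ≤ L′]‖𝓕θ‖² + Σ'[13/10·|k₀| ≤ γ|k₁|]‖𝓕θ‖² ≤ 2(πL′)²∫(∫_{−1/(4L′)}^{1/(4L′)} θ(x + ue₀)du)²dx + (π/(π−1))²(2B)²|Gᶜ|`.
[cite: Grafakos2014, Prop. 3.2.7 (3)] -/
theorem tsum_strip_add_cone_le_window_add_area {θ : UnitAddTorus (Fin 2) → ℝ} (hθ : Continuous θ) {B : ℝ}
    (hB : ∀ x, |θ x| ≤ B) (γ σ : ℝ) {L' : ℝ} (hL' : 0 < L') (hσ : |σ| = 1) {G : Set (UnitAddTorus (Fin 2))}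
    (hG : MeasurableSet G)
    (hflat : ∀ x ∈ G, ∀ u ∈ Set.uIcc (-(1 / (2 * ((13 / 10 - 1) * L')))) (1 / (2 * ((13 / 10 - 1) * L'))),
      θ (x + fun j => (((u * (![1, σ * γ] : Fin 2 → ℝ) j : ℝ)) : UnitAddCircle)) = θ x) :
    ∑' k : Fin 2 → ℤ, (if |((k 0 : ℤ) : ℝ)| ≤ L' then (1 : ℝ) else 0) * ‖mFourierCoeff (fun x => (θ x : ℂ)) k‖ ^ 2 +
        ∑' k : Fin 2 → ℤ, (if 13 / 10 * |((k 0 : ℤ) : ℝ)| ≤ γ * |((k 1 : ℤ) : ℝ)| then (1 : ℝ) else 0) *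
          ‖mFourierCoeff (fun x => (θ x : ℂ)) k‖ ^ 2 ≤
      2 * ((Real.pi * L') ^ 2 * ∫ x : UnitAddTorus (Fin 2),
          (∫ u in (-(1 / (4 * L')))..(1 / (4 * L')), θ (x + Pi.single 0 ((u : ℝ) : UnitAddCircle))) ^ 2) +
        (Real.pi / (Real.pi - 1)) ^ 2 * ((2 * B) ^ 2 * volume.real Gᶜ) := by
  have hM : 0 < (13 / 10 - 1) * L' := by positivity
  have h1 := tsum_strip_add_cone_le_windows hθ γ σ hL' hσ
  have h2 := integral_sq_sub_lineAvg_le hθ hB (![1, σ * γ] : Fin 2 → ℝ) hM hG hflat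
  have h3 := mul_le_mul_of_nonneg_left h2 (sq_nonneg (Real.pi / (Real.pi - 1)))
  linarith

/-! ## General crest slope `v = (1, t)`, `a|t| > γ`

The phase-start cells of the inviscid iterate are constant along the direction `(1, t_n)` orthogonal to their common wave
vector, with `γ|k_{c,1}|/|k_{c,0}| = γ/|t_n| < 13/10` (cells inside the cone) but not exactly `1`; the reduction of
`…LineAverage` §5 holds for every such slope with margin `a|t|/γ − 1` in place of `a − 1`. -/

/-- **Steep modes off the strip are far from the hyperplane `k₀ + tk₁ = 0`**: for `γ > 0`, `a|t| > γ` and any `L′`,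
`[a|k₀| ≤ γ|k₁|] ≤ [|k₀| ≤ L′] + [(a|t|/γ − 1)L′ ≤ |k₀ + tk₁|]`. [folklore] -/
theorem cone_indicator_le_strip_add_antislab_slope {γ a : ℝ} (t L' : ℝ) (hγ : 0 < γ) (hat : γ < a * |t|)
    (k : Fin 2 → ℤ) :
    (if a * |((k 0 : ℤ) : ℝ)| ≤ γ * |((k 1 : ℤ) : ℝ)| then (1 : ℝ) else 0) ≤
      (if |((k 0 : ℤ) : ℝ)| ≤ L' then (1 : ℝ) else 0) +
        (if (a * |t| / γ - 1) * L' ≤ |∑ j, (k j : ℝ) * (![1, t] : Fin 2 → ℝ) j| then (1 : ℝ) else 0) := by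
  have hsum : ∑ j, (k j : ℝ) * (![1, t] : Fin 2 → ℝ) j = ((k 0 : ℤ) : ℝ) + ((k 1 : ℤ) : ℝ) * t := by
    simp [Fin.sum_univ_two]
  rw [hsum]
  have hm : 0 < a * |t| / γ - 1 := by rw [sub_pos, lt_div_iff₀ hγ, one_mul]; exact hat
  by_cases hc : a * |((k 0 : ℤ) : ℝ)| ≤ γ * |((k 1 : ℤ) : ℝ)|
  · by_cases hs : |((k 0 : ℤ) : ℝ)| ≤ L'
    · rw [if_pos hc, if_pos hs]; split_ifs <;> norm_num
    · have hfar : (a * |t| / γ - 1) * L' ≤ |((k 0 : ℤ) : ℝ) + ((k 1 : ℤ) : ℝ) * t| := by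
        have h1 : |((k 1 : ℤ) : ℝ) * t| = |t| * |((k 1 : ℤ) : ℝ)| := by rw [abs_mul, mul_comm]
        have h2 : |((k 1 : ℤ) : ℝ) * t| - |((k 0 : ℤ) : ℝ)| ≤ |((k 0 : ℤ) : ℝ) + ((k 1 : ℤ) : ℝ) * t| := by
          have h := abs_sub_abs_le_abs_sub (((k 1 : ℤ) : ℝ) * t) (-((k 0 : ℤ) : ℝ))
          rwa [abs_neg, sub_neg_eq_add, add_comm] at h
        -- `|t|·|k₁| ≥ (a|t|/γ)|k₀|`
        have h3 : a * |t| / γ * |((k 0 : ℤ) : ℝ)| ≤ |t| * |((k 1 : ℤ) : ℝ)| := by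
          rw [div_mul_eq_mul_div, div_le_iff₀ hγ]
          calc a * |t| * |((k 0 : ℤ) : ℝ)| = |t| * (a * |((k 0 : ℤ) : ℝ)|) := by ring
            _ ≤ |t| * (γ * |((k 1 : ℤ) : ℝ)|) := mul_le_mul_of_nonneg_left hc (abs_nonneg t)
            _ = |t| * |((k 1 : ℤ) : ℝ)| * γ := by ring
        have h4 : (a * |t| / γ - 1) * L' ≤ (a * |t| / γ - 1) * |((k 0 : ℤ) : ℝ)| :=
          mul_le_mul_of_nonneg_left (le_of_not_ge hs) hm.le
        nlinarith
      rw [if_pos hc, if_neg hs, if_pos hfar]; norm_num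
  · rw [if_neg hc]; split_ifs <;> norm_num

/-- **Off-cone channel of a continuous real field, general crest slope**: for `γ > 0`, `a|t| > γ`, `L′ > 0`,
`M = (a|t|/γ − 1)L′`:
`Σ'[a|k₀| ≤ γ|k₁|]‖𝓕θ‖² ≤ Σ'[|k₀| ≤ L′]‖𝓕θ‖² + (π/(π−1))²∫(θ(x) − M∫_{−1/(2M)}^{1/(2M)} θ(x + u(1,t))du)²dx`.
[cite: Grafakos2014, Prop. 3.2.7 (3)] -/
theorem tsum_cone_real_le_strip_add_lineDeviation_slope {θ : UnitAddTorus (Fin 2) → ℝ} (hθ : Continuous θ) {γ a : ℝ}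
    (t : ℝ) {L' : ℝ} (hγ : 0 < γ) (hat : γ < a * |t|) (hL' : 0 < L') :
    ∑' k : Fin 2 → ℤ, (if a * |((k 0 : ℤ) : ℝ)| ≤ γ * |((k 1 : ℤ) : ℝ)| then (1 : ℝ) else 0) *
        ‖mFourierCoeff (fun x => (θ x : ℂ)) k‖ ^ 2 ≤
      ∑' k : Fin 2 → ℤ, (if |((k 0 : ℤ) : ℝ)| ≤ L' then (1 : ℝ) else 0) * ‖mFourierCoeff (fun x => (θ x : ℂ)) k‖ ^ 2 +
        (Real.pi / (Real.pi - 1)) ^ 2 * ∫ x : UnitAddTorus (Fin 2),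
          (θ x - (a * |t| / γ - 1) * L' *
            ∫ u in (-(1 / (2 * ((a * |t| / γ - 1) * L'))))..(1 / (2 * ((a * |t| / γ - 1) * L'))),
              θ (x + fun j => (((u * (![1, t] : Fin 2 → ℝ) j : ℝ)) : UnitAddCircle))) ^ 2 := by
  have hθc : Continuous (fun x => (θ x : ℂ)) := Complex.continuous_ofReal.comp hθ
  have hsq := hasSum_sq_mFourierCoeff_of_continuous hθc
  have hm : 0 < a * |t| / γ - 1 := by rw [sub_pos, lt_div_iff₀ hγ, one_mul]; exact hat
  have hM : 0 < (a * |t| / γ - 1) * L' := mul_pos hm hL'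
  -- pointwise reduction summed
  have hsI : ∀ (p : (Fin 2 → ℤ) → Prop) [DecidablePred p],
      Summable fun k => (if p k then (1 : ℝ) else 0) * ‖mFourierCoeff (fun x => (θ x : ℂ)) k‖ ^ 2 := by
    intro p _
    refine Summable.of_nonneg_of_le (fun k => mul_nonneg (by split_ifs <;> norm_num) (sq_nonneg _)) (fun k => ?_)
      hsq.summable
    split_ifs <;> simp
  have h1 := hsI (fun k => |((k 0 : ℤ) : ℝ)| ≤ L')
  have h2 := hsI (fun k => (a * |t| / γ - 1) * L' ≤ |∑ j, (k j : ℝ) * (![1, t] : Fin 2 → ℝ) j|)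
  have hred : ∑' k : Fin 2 → ℤ, (if a * |((k 0 : ℤ) : ℝ)| ≤ γ * |((k 1 : ℤ) : ℝ)| then (1 : ℝ) else 0) *
        ‖mFourierCoeff (fun x => (θ x : ℂ)) k‖ ^ 2 ≤
      ∑' k : Fin 2 → ℤ, (if |((k 0 : ℤ) : ℝ)| ≤ L' then (1 : ℝ) else 0) * ‖mFourierCoeff (fun x => (θ x : ℂ)) k‖ ^ 2 +
        ∑' k : Fin 2 → ℤ, (if (a * |t| / γ - 1) * L' ≤ |∑ j, (k j : ℝ) * (![1, t] : Fin 2 → ℝ) j| then (1 : ℝ) else 0) *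
          ‖mFourierCoeff (fun x => (θ x : ℂ)) k‖ ^ 2 := by
    rw [← (h1.hasSum.add h2.hasSum).tsum_eq]
    refine Summable.tsum_le_tsum (fun k => ?_) (hsI _) (h1.add h2)
    rw [← add_mul]
    exact mul_le_mul_of_nonneg_right (cone_indicator_le_strip_add_antislab_slope t L' hγ hat k) (sq_nonneg _)
  have hanti := tsum_antislab_le_sub_lineWindowAvg hθc (![1, t] : Fin 2 → ℝ) hM
  have e : ∀ x : UnitAddTorus (Fin 2), ‖(θ x : ℂ) - (((a * |t| / γ - 1) * L' : ℝ) : ℂ) *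
      ∫ u in (-(1 / (2 * ((a * |t| / γ - 1) * L'))))..(1 / (2 * ((a * |t| / γ - 1) * L'))),
        ((θ (x + fun j => (((u * (![1, t] : Fin 2 → ℝ) j : ℝ)) : UnitAddCircle)) : ℝ) : ℂ)‖ ^ 2 =
      (θ x - (a * |t| / γ - 1) * L' *
        ∫ u in (-(1 / (2 * ((a * |t| / γ - 1) * L'))))..(1 / (2 * ((a * |t| / γ - 1) * L'))),
          θ (x + fun j => (((u * (![1, t] : Fin 2 → ℝ) j : ℝ)) : UnitAddCircle))) ^ 2 := by
    intro x
    rw [intervalIntegral.integral_ofReal, ← Complex.ofReal_mul, ← Complex.ofReal_sub, Complex.norm_real,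
      Real.norm_eq_abs, sq_abs]
  simp_rw [e] at hanti
  linarith

/-- **Strip + off-cone ≤ chord windows + non-flat AREA along a general crest slope**: for a continuous real field `θ`
on `T²` with `|θ| ≤ B`, `γ > 0`, `13/10·|t| > γ`, `L′ > 0`, `M = (13|t|/(10γ) − 1)L′`, and a measurable `G` with
`θ(x + u(1,t)) = θ(x)` for `x ∈ G`, `|u| ≤ 1/(2M)`:
`Σ'[|k₀| ≤ L′]‖𝓕θ‖² + Σ'[13/10·|k₀| ≤ γ|k₁|]‖𝓕θ‖² ≤ 2(πL′)²∫(∫_{−1/(4L′)}^{1/(4L′)} θ(x + ue₀)du)²dx + (π/(π−1))²(2B)²|Gᶜ|`.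
[cite: Grafakos2014, Prop. 3.2.7 (3)] -/
theorem tsum_strip_add_cone_le_window_add_area_slope {θ : UnitAddTorus (Fin 2) → ℝ} (hθ : Continuous θ) {B : ℝ}
    (hB : ∀ x, |θ x| ≤ B) {γ : ℝ} (t : ℝ) {L' : ℝ} (hγ : 0 < γ) (hat : γ < 13 / 10 * |t|) (hL' : 0 < L')
    {G : Set (UnitAddTorus (Fin 2))} (hG : MeasurableSet G)
    (hflat : ∀ x ∈ G, ∀ u ∈ Set.uIcc (-(1 / (2 * ((13 / 10 * |t| / γ - 1) * L')))) (1 / (2 * ((13 / 10 * |t| / γ - 1) * L'))),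
      θ (x + fun j => (((u * (![1, t] : Fin 2 → ℝ) j : ℝ)) : UnitAddCircle)) = θ x) :
    ∑' k : Fin 2 → ℤ, (if |((k 0 : ℤ) : ℝ)| ≤ L' then (1 : ℝ) else 0) * ‖mFourierCoeff (fun x => (θ x : ℂ)) k‖ ^ 2 +
        ∑' k : Fin 2 → ℤ, (if 13 / 10 * |((k 0 : ℤ) : ℝ)| ≤ γ * |((k 1 : ℤ) : ℝ)| then (1 : ℝ) else 0) *
          ‖mFourierCoeff (fun x => (θ x : ℂ)) k‖ ^ 2 ≤
      2 * ((Real.pi * L') ^ 2 * ∫ x : UnitAddTorus (Fin 2),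
          (∫ u in (-(1 / (4 * L')))..(1 / (4 * L')), θ (x + Pi.single 0 ((u : ℝ) : UnitAddCircle))) ^ 2) +
        (Real.pi / (Real.pi - 1)) ^ 2 * ((2 * B) ^ 2 * volume.real Gᶜ) := by
  have hm : 0 < 13 / 10 * |t| / γ - 1 := by rw [sub_pos, lt_div_iff₀ hγ, one_mul]; exact hat
  have hM : 0 < (13 / 10 * |t| / γ - 1) * L' := mul_pos hm hL'
  have hstrip := tsum_strip_real_le_windowAvg hθ (0 : Fin 2) hL'
  have hcone := tsum_cone_real_le_strip_add_lineDeviation_slope hθ t hγ hat hL'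
  have h2 := integral_sq_sub_lineAvg_le hθ hB (![1, t] : Fin 2 → ℝ) hM hG hflat
  have h3 := mul_le_mul_of_nonneg_left h2 (sq_nonneg (Real.pi / (Real.pi - 1)))
  linarith

/-! ## The disjoint form: low band + HIGH off-cone (factor `1` on the strip)

`K1Ledger.From.k1Localised_of_thin_lowBand_offCone(_frequently)` asks for `LowBand_n + HighOffCone_n ≤ Q` with the DISJOINT
channels `[|k₀| < L′]` and `[L′ ≤ |k₀| ∧ 13/10·|k₀| < γ|k₁|]`; the high off-cone channel is an anti-slab by itself, so the
strip is paid ONCE: `LowBand + HighOffCone ≤ (πL′)²∫(chord window)² + (π/(π−1))²∫(crest deviation)²`. -/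

/-- **High off-cone modes are far from the crest hyperplane**: for `γ > 0`, `13/10·|t| > γ`, `M = (13|t|/(10γ) − 1)L′`,
`[L′ ≤ |k₀| ∧ 13/10·|k₀| < γ|k₁|] ≤ [M ≤ |k₀ + tk₁|]`. [folklore] -/
theorem highOffCone_indicator_le_antislab_slope {γ : ℝ} (t L' : ℝ) (hγ : 0 < γ) (hat : γ < 13 / 10 * |t|)
    (k : Fin 2 → ℤ) :
    (if L' ≤ |((k 0 : ℤ) : ℝ)| ∧ 13 / 10 * |((k 0 : ℤ) : ℝ)| < γ * |((k 1 : ℤ) : ℝ)| then (1 : ℝ) else 0) ≤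
      (if (13 / 10 * |t| / γ - 1) * L' ≤ |∑ j, (k j : ℝ) * (![1, t] : Fin 2 → ℝ) j| then (1 : ℝ) else 0) := by
  have hsum : ∑ j, (k j : ℝ) * (![1, t] : Fin 2 → ℝ) j = ((k 0 : ℤ) : ℝ) + ((k 1 : ℤ) : ℝ) * t := by
    simp [Fin.sum_univ_two]
  rw [hsum]
  have hm : 0 < 13 / 10 * |t| / γ - 1 := by rw [sub_pos, lt_div_iff₀ hγ, one_mul]; exact hat
  split_ifs with hc hfar
  · norm_num
  · exfalso
    obtain ⟨hs, hc⟩ := hc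
    apply hfar
    have h2 : |((k 1 : ℤ) : ℝ) * t| - |((k 0 : ℤ) : ℝ)| ≤ |((k 0 : ℤ) : ℝ) + ((k 1 : ℤ) : ℝ) * t| := by
      have h := abs_sub_abs_le_abs_sub (((k 1 : ℤ) : ℝ) * t) (-((k 0 : ℤ) : ℝ))
      rwa [abs_neg, sub_neg_eq_add, add_comm] at h
    have h3 : 13 / 10 * |t| / γ * |((k 0 : ℤ) : ℝ)| ≤ |((k 1 : ℤ) : ℝ) * t| := by
      rw [abs_mul, div_mul_eq_mul_div, div_le_iff₀ hγ]
      calc 13 / 10 * |t| * |((k 0 : ℤ) : ℝ)| = |t| * (13 / 10 * |((k 0 : ℤ) : ℝ)|) := by ring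
        _ ≤ |t| * (γ * |((k 1 : ℤ) : ℝ)|) := mul_le_mul_of_nonneg_left hc.le (abs_nonneg t)
        _ = |((k 1 : ℤ) : ℝ)| * |t| * γ := by ring
    have h4 : (13 / 10 * |t| / γ - 1) * L' ≤ (13 / 10 * |t| / γ - 1) * |((k 0 : ℤ) : ℝ)| :=
      mul_le_mul_of_nonneg_left hs hm.le
    nlinarith
  · norm_num
  · norm_num

/-- **Low band + high off-cone in window form** (the left-hand side of `hch` of
`K1Ledger.From.k1Localised_of_thin_lowBand_offCone`, strip paid once): for a continuous real field `θ` on `T²`, `γ > 0`,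
`13/10·|t| > γ`, `L′ > 0`, `M = (13|t|/(10γ) − 1)L′`:
`Σ'[|k₀| < L′]‖𝓕θ‖² + Σ'[L′ ≤ |k₀| ∧ 13/10·|k₀| < γ|k₁|]‖𝓕θ‖²
  ≤ (πL′)²∫(∫_{−1/(4L′)}^{1/(4L′)} θ(x + ue₀)du)²dx + (π/(π−1))²∫(θ(x) − M∫_{−1/(2M)}^{1/(2M)} θ(x + u(1,t))du)²dx`.
[cite: Grafakos2014, Prop. 3.2.7 (3)] -/
theorem tsum_lowBand_add_highOffCone_le_windows_slope {θ : UnitAddTorus (Fin 2) → ℝ} (hθ : Continuous θ) {γ : ℝ}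
    (t : ℝ) {L' : ℝ} (hγ : 0 < γ) (hat : γ < 13 / 10 * |t|) (hL' : 0 < L') :
    ∑' k : Fin 2 → ℤ, (if |((k 0 : ℤ) : ℝ)| < L' then (1 : ℝ) else 0) * ‖mFourierCoeff (fun x => (θ x : ℂ)) k‖ ^ 2 +
        ∑' k : Fin 2 → ℤ, (if L' ≤ |((k 0 : ℤ) : ℝ)| ∧ 13 / 10 * |((k 0 : ℤ) : ℝ)| < γ * |((k 1 : ℤ) : ℝ)| then (1 : ℝ)
          else 0) * ‖mFourierCoeff (fun x => (θ x : ℂ)) k‖ ^ 2 ≤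
      (Real.pi * L') ^ 2 * (∫ x : UnitAddTorus (Fin 2),
          (∫ u in (-(1 / (4 * L')))..(1 / (4 * L')), θ (x + Pi.single 0 ((u : ℝ) : UnitAddCircle))) ^ 2) +
        (Real.pi / (Real.pi - 1)) ^ 2 * ∫ x : UnitAddTorus (Fin 2),
          (θ x - (13 / 10 * |t| / γ - 1) * L' *
            ∫ u in (-(1 / (2 * ((13 / 10 * |t| / γ - 1) * L'))))..(1 / (2 * ((13 / 10 * |t| / γ - 1) * L'))),
              θ (x + fun j => (((u * (![1, t] : Fin 2 → ℝ) j : ℝ)) : UnitAddCircle))) ^ 2 := by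
  have hθc : Continuous (fun x => (θ x : ℂ)) := Complex.continuous_ofReal.comp hθ
  have hsq := hasSum_sq_mFourierCoeff_of_continuous hθc
  have hm : 0 < 13 / 10 * |t| / γ - 1 := by rw [sub_pos, lt_div_iff₀ hγ, one_mul]; exact hat
  have hM : 0 < (13 / 10 * |t| / γ - 1) * L' := mul_pos hm hL'
  have hsI : ∀ (p : (Fin 2 → ℤ) → Prop) [DecidablePred p],
      Summable fun k => (if p k then (1 : ℝ) else 0) * ‖mFourierCoeff (fun x => (θ x : ℂ)) k‖ ^ 2 := by
    intro p _
    refine Summable.of_nonneg_of_le (fun k => mul_nonneg (by split_ifs <;> norm_num) (sq_nonneg _)) (fun k => ?_)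
      hsq.summable
    split_ifs <;> simp
  -- low band ≤ strip ≤ chord window
  have hlow : ∑' k : Fin 2 → ℤ, (if |((k 0 : ℤ) : ℝ)| < L' then (1 : ℝ) else 0) * ‖mFourierCoeff (fun x => (θ x : ℂ)) k‖ ^ 2 ≤
      ∑' k : Fin 2 → ℤ, (if |((k 0 : ℤ) : ℝ)| ≤ L' then (1 : ℝ) else 0) * ‖mFourierCoeff (fun x => (θ x : ℂ)) k‖ ^ 2 := by
    refine Summable.tsum_le_tsum (fun k => mul_le_mul_of_nonneg_right ?_ (sq_nonneg _)) (hsI _) (hsI _)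
    split_ifs with h1 h2 <;> first | exact absurd h1.le h2 | norm_num
  have hstrip := tsum_strip_real_le_windowAvg hθ (0 : Fin 2) hL'
  -- high off-cone ≤ anti-slab ≤ crest deviation
  have hhigh : ∑' k : Fin 2 → ℤ, (if L' ≤ |((k 0 : ℤ) : ℝ)| ∧ 13 / 10 * |((k 0 : ℤ) : ℝ)| < γ * |((k 1 : ℤ) : ℝ)| then (1 : ℝ)
          else 0) * ‖mFourierCoeff (fun x => (θ x : ℂ)) k‖ ^ 2 ≤
      ∑' k : Fin 2 → ℤ, (if (13 / 10 * |t| / γ - 1) * L' ≤ |∑ j, (k j : ℝ) * (![1, t] : Fin 2 → ℝ) j| then (1 : ℝ) else 0) *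
          ‖mFourierCoeff (fun x => (θ x : ℂ)) k‖ ^ 2 :=
    Summable.tsum_le_tsum (fun k => mul_le_mul_of_nonneg_right (highOffCone_indicator_le_antislab_slope t L' hγ hat k)
      (sq_nonneg _)) (hsI _) (hsI _)
  have hanti := tsum_antislab_le_sub_lineWindowAvg hθc (![1, t] : Fin 2 → ℝ) hM
  have e : ∀ x : UnitAddTorus (Fin 2), ‖(θ x : ℂ) - (((13 / 10 * |t| / γ - 1) * L' : ℝ) : ℂ) *
      ∫ u in (-(1 / (2 * ((13 / 10 * |t| / γ - 1) * L'))))..(1 / (2 * ((13 / 10 * |t| / γ - 1) * L'))),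
        ((θ (x + fun j => (((u * (![1, t] : Fin 2 → ℝ) j : ℝ)) : UnitAddCircle)) : ℝ) : ℂ)‖ ^ 2 =
      (θ x - (13 / 10 * |t| / γ - 1) * L' *
        ∫ u in (-(1 / (2 * ((13 / 10 * |t| / γ - 1) * L'))))..(1 / (2 * ((13 / 10 * |t| / γ - 1) * L'))),
          θ (x + fun j => (((u * (![1, t] : Fin 2 → ℝ) j : ℝ)) : UnitAddCircle))) ^ 2 := by
    intro x
    rw [intervalIntegral.integral_ofReal, ← Complex.ofReal_mul, ← Complex.ofReal_sub, Complex.norm_real,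
      Real.norm_eq_abs, sq_abs]
  simp_rw [e] at hanti
  linarith

/-- **Low band + high off-cone ≤ chord windows + non-flat crest AREA** (strip paid once): for a continuous real field `θ`
on `T²` with `|θ| ≤ B`, `γ > 0`, `13/10·|t| > γ`, `L′ > 0`, `M = (13|t|/(10γ) − 1)L′`, and a measurable `G` with
`θ(x + u(1,t)) = θ(x)` for `x ∈ G`, `|u| ≤ 1/(2M)`:
`Σ'[|k₀| < L′]‖𝓕θ‖² + Σ'[L′ ≤ |k₀| ∧ 13/10·|k₀| < γ|k₁|]‖𝓕θ‖² ≤ (πL′)²∫(∫_{−1/(4L′)}^{1/(4L′)} θ(x + ue₀)du)²dx + (π/(π−1))²(2B)²|Gᶜ|`.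
[cite: Grafakos2014, Prop. 3.2.7 (3)] -/
theorem tsum_lowBand_add_highOffCone_le_window_add_area_slope {θ : UnitAddTorus (Fin 2) → ℝ} (hθ : Continuous θ)
    {B : ℝ} (hB : ∀ x, |θ x| ≤ B) {γ : ℝ} (t : ℝ) {L' : ℝ} (hγ : 0 < γ) (hat : γ < 13 / 10 * |t|) (hL' : 0 < L')
    {G : Set (UnitAddTorus (Fin 2))} (hG : MeasurableSet G)
    (hflat : ∀ x ∈ G, ∀ u ∈ Set.uIcc (-(1 / (2 * ((13 / 10 * |t| / γ - 1) * L')))) (1 / (2 * ((13 / 10 * |t| / γ - 1) * L'))),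
      θ (x + fun j => (((u * (![1, t] : Fin 2 → ℝ) j : ℝ)) : UnitAddCircle)) = θ x) :
    ∑' k : Fin 2 → ℤ, (if |((k 0 : ℤ) : ℝ)| < L' then (1 : ℝ) else 0) * ‖mFourierCoeff (fun x => (θ x : ℂ)) k‖ ^ 2 +
        ∑' k : Fin 2 → ℤ, (if L' ≤ |((k 0 : ℤ) : ℝ)| ∧ 13 / 10 * |((k 0 : ℤ) : ℝ)| < γ * |((k 1 : ℤ) : ℝ)| then (1 : ℝ)
          else 0) * ‖mFourierCoeff (fun x => (θ x : ℂ)) k‖ ^ 2 ≤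
      (Real.pi * L') ^ 2 * (∫ x : UnitAddTorus (Fin 2),
          (∫ u in (-(1 / (4 * L')))..(1 / (4 * L')), θ (x + Pi.single 0 ((u : ℝ) : UnitAddCircle))) ^ 2) +
        (Real.pi / (Real.pi - 1)) ^ 2 * ((2 * B) ^ 2 * volume.real Gᶜ) := by
  have hm : 0 < 13 / 10 * |t| / γ - 1 := by rw [sub_pos, lt_div_iff₀ hγ, one_mul]; exact hat
  have hM : 0 < (13 / 10 * |t| / γ - 1) * L' := mul_pos hm hL'
  have h1 := tsum_lowBand_add_highOffCone_le_windows_slope hθ t hγ hat hL'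
  have h2 := integral_sq_sub_lineAvg_le hθ hB (![1, t] : Fin 2 → ℝ) hM hG hflat
  have h3 := mul_le_mul_of_nonneg_left h2 (sq_nonneg (Real.pi / (Real.pi - 1)))
  linarith

/-- **Low band + high off-cone ≤ chord windows + η² + non-flat AREA** (approximately flat crest segments — the form the
Gaussian-rounded cascade needs): for a continuous real field `θ` on `T²` with `|θ| ≤ B`, `γ > 0`, `13/10·|t| > γ`, `L′ > 0`,
`M = (13|t|/(10γ) − 1)L′`, and a measurable `G` with `|θ(x + u(1,t)) − θ(x)| ≤ η` for `x ∈ G`, `|u| ≤ 1/(2M)`: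
`Σ'[|k₀| < L′]‖𝓕θ‖² + Σ'[L′ ≤ |k₀| ∧ 13/10·|k₀| < γ|k₁|]‖𝓕θ‖²
  ≤ (πL′)²∫(∫_{−1/(4L′)}^{1/(4L′)} θ(x + ue₀)du)²dx + (π/(π−1))²(η² + (2B)²|Gᶜ|)`. [cite: Grafakos2014, Prop. 3.2.7 (3)] -/
theorem tsum_lowBand_add_highOffCone_le_window_add_approx_slope {θ : UnitAddTorus (Fin 2) → ℝ} (hθ : Continuous θ)
    {B : ℝ} (hB : ∀ x, |θ x| ≤ B) {γ : ℝ} (t : ℝ) {L' : ℝ} (hγ : 0 < γ) (hat : γ < 13 / 10 * |t|) (hL' : 0 < L')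
    {η : ℝ} {G : Set (UnitAddTorus (Fin 2))} (hG : MeasurableSet G)
    (happrox : ∀ x ∈ G, ∀ u ∈ Set.uIcc (-(1 / (2 * ((13 / 10 * |t| / γ - 1) * L')))) (1 / (2 * ((13 / 10 * |t| / γ - 1) * L'))),
      |θ (x + fun j => (((u * (![1, t] : Fin 2 → ℝ) j : ℝ)) : UnitAddCircle)) - θ x| ≤ η) :
    ∑' k : Fin 2 → ℤ, (if |((k 0 : ℤ) : ℝ)| < L' then (1 : ℝ) else 0) * ‖mFourierCoeff (fun x => (θ x : ℂ)) k‖ ^ 2 +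
        ∑' k : Fin 2 → ℤ, (if L' ≤ |((k 0 : ℤ) : ℝ)| ∧ 13 / 10 * |((k 0 : ℤ) : ℝ)| < γ * |((k 1 : ℤ) : ℝ)| then (1 : ℝ)
          else 0) * ‖mFourierCoeff (fun x => (θ x : ℂ)) k‖ ^ 2 ≤
      (Real.pi * L') ^ 2 * (∫ x : UnitAddTorus (Fin 2),
          (∫ u in (-(1 / (4 * L')))..(1 / (4 * L')), θ (x + Pi.single 0 ((u : ℝ) : UnitAddCircle))) ^ 2) +
        (Real.pi / (Real.pi - 1)) ^ 2 * (η ^ 2 + (2 * B) ^ 2 * volume.real Gᶜ) := by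
  have hm : 0 < 13 / 10 * |t| / γ - 1 := by rw [sub_pos, lt_div_iff₀ hγ, one_mul]; exact hat
  have hM : 0 < (13 / 10 * |t| / γ - 1) * L' := mul_pos hm hL'
  have h1 := tsum_lowBand_add_highOffCone_le_windows_slope hθ t hγ hat hL'
  have h2 := integral_sq_sub_lineAvg_le_of_approx hθ hB (![1, t] : Fin 2 → ℝ) hM hG happrox
  have h3 := mul_le_mul_of_nonneg_left h2 (sq_nonneg (Real.pi / (Real.pi - 1)))
  linarith

end Summit.AnomalousDissipation.AnomalousDissipation.Theorems.SawtoothPulseCascade.K1Start
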